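import Mathlib
import Literature.Analysis.FluidPDE.MollifiedEulerConePressure
import Literature.Analysis.FluidPDE.EulerReynoldsLocalization
import HarnessLib

/-!
# Ladder gluing of steady Euler–Reynolds subsolutions, I: local integration by parts for
# divergence-free stresses and radial cut-offs across a shell

Analysis/FluidPDE support file (everything proved; no definitions, no named facts). First of the
`EulerReynoldsLadderGluing*` files, which formalise the ASSEMBLY STEP ("tool T8") of the
mollifier-ladder construction of the free-space sink completion of a self-similar weak Euler cone
(route PointSink of the anomalous-dissipation summit, stub `stub_freeSpaceSinkCompletion` of
crux stmt-AnomalousDissipation-19035): smooth Euler–Reynolds layers living on shells that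
accumulate at a sphere `|x| = r₀` from outside are glued, and the glued pair has to be matched with
the rough cone inside the sphere WITHOUT any trace theory. The matching argument (file
`EulerReynoldsLadderGluingLimit`) only ever integrates by parts against test fields `χ w`, where
`w` is the given solenoidal test field and `χ` a radial cut-off whose transition shell lies inside
ONE pure layer; this file provides exactly these integrations by parts, in the coordinate format of
the summit (`(∇w)ᵢⱼ = ∂ⱼwᵢ = (Dw eⱼ)ᵢ`, `eⱼ = EuclideanSpace.single j 1`, stresses as
`ℝ³ → Fin 3 → Fin 3 → ℝ`):

* `integral_sum_sum_mul_fderiv_apply_eq_zero` — **a `C¹` row-divergence-free stress `M` on an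
  open set `W` is orthogonal to `∇φ` for every `C¹` vector test `φ` compactly supported in `W`**:
  `∫ Σᵢⱼ Mᵢⱼ (Dφ eⱼ)ᵢ = 0` (`M` may be arbitrary off `W`);
* `integral_mul_sum_sum_eq_neg` — the cut-off commutator: for `χ ∈ C¹`, `w ∈ C¹_c` with
  `tsupport χ ∩ tsupport w ⊆ W`, `∫ χ Σᵢⱼ Mᵢⱼ (Dw eⱼ)ᵢ = -∫ Σᵢⱼ Mᵢⱼ (∂ⱼχ) wᵢ`;
* `integral_mul_sum_sum_eq_of_fderiv_ne` — hence two such stresses (on possibly different open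
  sets) that AGREE WHEREVER `∇χ ≠ 0` have the same cut-off pairing `∫ χ M : ∇w`; this is the
  telescoping step across one pure layer of the ladder;
* `integral_inner_gradient_eq_zero_of_tsupport_subset`, `integral_mul_inner_gradient_eq_neg` —
  the same two facts for a `C¹` divergence-free VECTOR field and scalar tests (used for the weak
  divergence-free constraint of the glued velocity);
* `exists_radial_cutoff` — for `0 < s < s'` a smooth pair `χ + ψ = 1`, `0 ≤ ψ ≤ 1`, `ψ = 1` on
  `|x| ≤ s`, `ψ = 0` off `|x| < s'` (compact support), `tsupport χ ⊆ {s < |x|}` and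
  `∇χ ≠ 0 ⟹ s < |x| < s'` (Mathlib's `ContDiffBump` at the origin).

## Mathlib / tree search

Mathlib (this pin): `integral_mul_fderiv_eq_neg_fderiv_mul_of_integrable` (whole-space IBP with
integrability side conditions), `ContDiffBump`, `tsupport_smul_subset_left/right`,
`tsupport_fderiv_apply_subset`; no IBP "on an open set against tests supported inside". Tree: the
scalar local IBP exists as `SereginZajaczkowski2007.integral_mul_fderiv_apply_eq_neg_of_tsupport_subset`
and `continuous_mul_of_tsupport_subset'` (`SereginZajaczkowski2007L42*.lean`, heavy axisymmetric
imports — private copies below, marked), `MollifiedEulerCone.fderiv_apply_coord`,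
`sum_sum_ite_mul_fderiv_apply_eq` (`EulerReynoldsLocalization`). Searched
`lean search 'tsupport_subset|Ladder|gluing|EulerReynolds'` (2026-08-17): no stress version.

## References

* C. De Lellis, L. Székelyhidi Jr., Arch. Ration. Mech. Anal. 195 (2010) 225–260, §2
  (subsolutions; gluing of stresses by partitions of unity). [DeLellisSzekelyhidi2010]
* G. P. Galdi, *An Introduction to the Mathematical Theory of the Navier–Stokes Equations*
  (2011), §III.4 (cut-offs of solenoidal fields). [Galdi2011]
-/

noncomputable section

open MeasureTheory Filter Topology Set Metric Function
open scoped RealInnerProductSpace ContDiff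

namespace Literature.Analysis.FluidPDE

namespace EulerReynoldsLadder

/-! ### Products supported inside an open set -/

/-- A product `f · g` with `f` continuous, `tsupport f ⊆ W`, `W` open, and `g` continuous on `W`
is continuous (it vanishes near every point outside `W`). Private copy of the tree's
`SereginZajaczkowski2007.continuous_mul_of_tsupport_subset'` (not imported: heavy axisymmetric
import chain). [folklore] -/
private theorem continuous_mul_of_tsupport_subset {X : Type*} [TopologicalSpace X] {f g : X → ℝ}
    {W : Set X} (hW : IsOpen W) (hf : Continuous f) (hfW : tsupport f ⊆ W)
    (hg : ContinuousOn g W) : Continuous fun x => f x * g x := by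
  rw [continuous_iff_continuousAt]
  intro x
  by_cases hx : x ∈ W
  · exact hf.continuousAt.mul (hg.continuousAt (hW.mem_nhds hx))
  · have hx' : x ∉ tsupport f := fun h => hx (hfW h)
    have h0 : (fun y => f y * g y) =ᶠ[𝓝 x] fun _ => 0 := by
      filter_upwards [notMem_tsupport_iff_eventuallyEq.1 hx'] with y hy
      rw [hy, Pi.zero_apply, zero_mul]
    exact continuousAt_const.congr h0.symm

/-- A product `f · g` with `f ∈ C_c`, `tsupport f ⊆ W`, `W` open, `g` continuous on `W`, is
integrable. [folklore] -/
theorem integrable_mul_of_tsupport_subset {W : Set (EuclideanSpace ℝ (Fin 3))} (hW : IsOpen W)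
    {f g : EuclideanSpace ℝ (Fin 3) → ℝ} (hf : Continuous f) (hfc : HasCompactSupport f)
    (hfW : tsupport f ⊆ W) (hg : ContinuousOn g W) :
    Integrable (fun x => f x * g x) :=
  (continuous_mul_of_tsupport_subset hW hf hfW hg).integrable_of_hasCompactSupport hfc.mul_right

/-- The topological support of a coordinate of a vector field lies in that of the field.
[folklore] -/
theorem tsupport_apply_subset (φ : EuclideanSpace ℝ (Fin 3) → EuclideanSpace ℝ (Fin 3))
    (i : Fin 3) : tsupport (fun y => φ y i) ⊆ tsupport φ :=
  closure_mono fun x hx h => hx (by simp [h])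

/-! ### Local integration by parts -/

/-- **Integration by parts without boundary terms, local form.** If `f ∈ C¹_c(ℝ³)` has
`tsupport f ⊆ W`, `W` open, and `g` is `C¹` on `W` (arbitrary elsewhere), then
`∫ f ∂ᵥg = -∫ (∂ᵥf) g`. Private copy of the tree's
`SereginZajaczkowski2007.integral_mul_fderiv_apply_eq_neg_of_tsupport_subset`. [folklore] -/
private theorem integral_mul_fderiv_apply_eq_neg_of_tsupport_subset
    {W : Set (EuclideanSpace ℝ (Fin 3))} (hW : IsOpen W) {f g : EuclideanSpace ℝ (Fin 3) → ℝ}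
    (hf : ContDiff ℝ 1 f) (hfc : HasCompactSupport f) (hfW : tsupport f ⊆ W)
    (hg : ContDiffOn ℝ 1 g W) (v : EuclideanSpace ℝ (Fin 3)) :
    ∫ x, f x * fderiv ℝ g x v = -∫ x, fderiv ℝ f x v * g x := by
  have hgc : ContinuousOn g W := hg.continuousOn
  have hgd : ∀ x ∈ W, DifferentiableAt ℝ g x := fun x hx =>
    (hg.contDiffAt (hW.mem_nhds hx)).differentiableAt one_ne_zero
  have hg'c : ContinuousOn (fun x => fderiv ℝ g x v) W :=
    (hg.continuousOn_fderiv_of_isOpen hW le_rfl).clm_apply continuousOn_const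
  have hf'c : Continuous fun x => fderiv ℝ f x v :=
    (hf.continuous_fderiv one_ne_zero).clm_apply continuous_const
  have hsub' : tsupport (fun x => fderiv ℝ f x v) ⊆ W :=
    (tsupport_fderiv_apply_subset ℝ v).trans hfW
  have i1 : Integrable (fun x => fderiv ℝ f x v * g x) :=
    integrable_mul_of_tsupport_subset hW hf'c (hfc.fderiv_apply (𝕜 := ℝ) v) hsub' hgc
  have i2 : Integrable (fun x => f x * fderiv ℝ g x v) :=
    integrable_mul_of_tsupport_subset hW hf.continuous hfc hfW hg'c
  have i3 : Integrable (fun x => f x * g x) :=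
    integrable_mul_of_tsupport_subset hW hf.continuous hfc hfW hgc
  exact integral_mul_fderiv_eq_neg_fderiv_mul_of_integrable i1 i2 i3
    (fun x _ => hf.differentiable one_ne_zero x) (fun x hx => hgd x (hfW hx))

/-- **A `C¹` divergence-free stress is orthogonal to gradients of vector tests, local form.**
Let `M : ℝ³ → ℝ^{3×3}` have `C¹` entries on an open set `W` with vanishing row-divergence
`Σⱼ ∂ⱼMᵢⱼ = 0` on `W`, and let `φ ∈ C¹_c(ℝ³; ℝ³)` with `tsupport φ ⊆ W`. Then
`∫ Σᵢⱼ Mᵢⱼ (Dφ eⱼ)ᵢ = 0` (entrywise integration by parts; the values of `M` off `W` are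
irrelevant). This is the form in which a smooth Euler–Reynolds layer `(U, S + P·Id)`, with
`div (S + P·Id) = 0` classically on its shell, enters the gluing. [folklore] -/
theorem integral_sum_sum_mul_fderiv_apply_eq_zero {W : Set (EuclideanSpace ℝ (Fin 3))}
    (hW : IsOpen W) {M : EuclideanSpace ℝ (Fin 3) → Fin 3 → Fin 3 → ℝ}
    (hM : ∀ i j, ContDiffOn ℝ 1 (fun x => M x i j) W)
    (hdiv : ∀ x ∈ W, ∀ i, ∑ j, fderiv ℝ (fun y => M y i j) x (EuclideanSpace.single j 1) = 0)
    {φ : EuclideanSpace ℝ (Fin 3) → EuclideanSpace ℝ (Fin 3)} (hφ : ContDiff ℝ 1 φ)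
    (hφc : HasCompactSupport φ) (hφW : tsupport φ ⊆ W) :
    ∫ x, ∑ i, ∑ j, M x i j * fderiv ℝ φ x (EuclideanSpace.single j 1) i = 0 := by
  -- the components of the test field
  have hφi : ∀ i, ContDiff ℝ 1 (fun y => φ y i) := fun i =>
    (EuclideanSpace.proj i : EuclideanSpace ℝ (Fin 3) →L[ℝ] ℝ).contDiff.comp hφ
  have hφic : ∀ i, HasCompactSupport (fun y => φ y i) := fun i =>
    hφc.comp_left (g := fun v : EuclideanSpace ℝ (Fin 3) => v i) rfl
  have hφiW : ∀ i, tsupport (fun y => φ y i) ⊆ W := fun i =>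
    (tsupport_apply_subset φ i).trans hφW
  have hφd : Differentiable ℝ φ := hφ.differentiable one_ne_zero
  have hcoord : ∀ x i j, fderiv ℝ φ x (EuclideanSpace.single j 1) i =
      fderiv ℝ (fun y => φ y i) x (EuclideanSpace.single j 1) := fun x i j =>
    (MollifiedEulerCone.fderiv_apply_coord hφd x _ i).symm
  simp_rw [hcoord]
  -- integrability of the terms before and after integrating by parts
  have hint : ∀ i j, Integrable (fun x =>
      M x i j * fderiv ℝ (fun y => φ y i) x (EuclideanSpace.single j 1)) := by
    intro i j
    have hc : Continuous fun x => fderiv ℝ (fun y => φ y i) x (EuclideanSpace.single j 1) :=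
      ((hφi i).continuous_fderiv one_ne_zero).clm_apply continuous_const
    have h := integrable_mul_of_tsupport_subset hW hc ((hφic i).fderiv_apply (𝕜 := ℝ) _)
      ((tsupport_fderiv_apply_subset ℝ _).trans (hφiW i)) (hM i j).continuousOn
    exact h.congr (Eventually.of_forall fun x => mul_comm _ _)
  have hint' : ∀ i j, Integrable (fun x =>
      φ x i * fderiv ℝ (fun y => M y i j) x (EuclideanSpace.single j 1)) := fun i j =>
    integrable_mul_of_tsupport_subset hW (hφi i).continuous (hφic i) (hφiW i)
      (((hM i j).continuousOn_fderiv_of_isOpen hW le_rfl).clm_apply continuousOn_const)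
  rw [integral_finsetSum _ fun i _ => integrable_finsetSum _ fun j _ => hint i j]
  refine Finset.sum_eq_zero fun i _ => ?_
  rw [integral_finsetSum _ fun j _ => hint i j]
  -- integrate by parts entrywise: `∫ Mᵢⱼ ∂ⱼφᵢ = -∫ φᵢ ∂ⱼMᵢⱼ`
  have hibp : ∀ j, ∫ x, M x i j * fderiv ℝ (fun y => φ y i) x (EuclideanSpace.single j 1) =
      -∫ x, φ x i * fderiv ℝ (fun y => M y i j) x (EuclideanSpace.single j 1) := by
    intro j
    have h := integral_mul_fderiv_apply_eq_neg_of_tsupport_subset hW (hφi i) (hφic i) (hφiW i)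
      (hM i j) (EuclideanSpace.single j 1)
    have hcomm : ∫ x, M x i j * fderiv ℝ (fun y => φ y i) x (EuclideanSpace.single j 1) =
        ∫ x, fderiv ℝ (fun y => φ y i) x (EuclideanSpace.single j 1) * M x i j :=
      integral_congr_ae (Eventually.of_forall fun x => mul_comm _ _)
    linarith
  simp_rw [hibp]
  rw [Finset.sum_neg_distrib, neg_eq_zero, ← integral_finsetSum _ fun j _ => hint' i j]
  refine integral_eq_zero_of_ae (Eventually.of_forall fun x => ?_)
  simp only [Pi.zero_apply]
  rw [← Finset.mul_sum]
  by_cases hx : x ∈ W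
  · rw [hdiv x hx i, mul_zero]
  · have h0 : φ x = 0 := image_eq_zero_of_notMem_tsupport fun h => hx (hφW h)
    simp [h0]

/-- **The cut-off commutator for a divergence-free stress.** With `M` as in
`integral_sum_sum_mul_fderiv_apply_eq_zero` on the open set `W`, a `C¹` cut-off `χ` and a `C¹`
compactly supported vector field `w` with `tsupport χ ∩ tsupport w ⊆ W`:
`∫ χ Σᵢⱼ Mᵢⱼ (Dw eⱼ)ᵢ = -∫ Σᵢⱼ Mᵢⱼ (∂ⱼχ) wᵢ` (test the stress against `φ = χ w` and expand
`∂ⱼ(χ wᵢ) = χ ∂ⱼwᵢ + (∂ⱼχ) wᵢ`). Note that `w` itself need NOT be supported in `W`. [folklore] -/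
theorem integral_mul_sum_sum_eq_neg {W : Set (EuclideanSpace ℝ (Fin 3))} (hW : IsOpen W)
    {M : EuclideanSpace ℝ (Fin 3) → Fin 3 → Fin 3 → ℝ}
    (hM : ∀ i j, ContDiffOn ℝ 1 (fun x => M x i j) W)
    (hdiv : ∀ x ∈ W, ∀ i, ∑ j, fderiv ℝ (fun y => M y i j) x (EuclideanSpace.single j 1) = 0)
    {χ : EuclideanSpace ℝ (Fin 3) → ℝ} (hχ : ContDiff ℝ 1 χ)
    {w : EuclideanSpace ℝ (Fin 3) → EuclideanSpace ℝ (Fin 3)} (hw : ContDiff ℝ 1 w)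
    (hwc : HasCompactSupport w) (hsub : tsupport χ ∩ tsupport w ⊆ W) :
    ∫ x, χ x * ∑ i, ∑ j, M x i j * fderiv ℝ w x (EuclideanSpace.single j 1) i =
      -∫ x, ∑ i, ∑ j, M x i j * (fderiv ℝ χ x (EuclideanSpace.single j 1) * w x i) := by
  have hφs : ContDiff ℝ 1 (fun x => χ x • w x) := hχ.smul hw
  have hφc : HasCompactSupport (fun x => χ x • w x) := hwc.smul_left (f := χ)
  have hφW : tsupport (fun x => χ x • w x) ⊆ W :=
    (subset_inter (tsupport_smul_subset_left χ w) (tsupport_smul_subset_right χ w)).trans hsub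
  have key := integral_sum_sum_mul_fderiv_apply_eq_zero hW hM hdiv hφs hφc hφW
  have hχd : Differentiable ℝ χ := hχ.differentiable one_ne_zero
  have hwd : Differentiable ℝ w := hw.differentiable one_ne_zero
  -- the product rule, coordinatewise
  have hprod : ∀ (x : EuclideanSpace ℝ (Fin 3)) (i j : Fin 3),
      fderiv ℝ (fun x => χ x • w x) x (EuclideanSpace.single j 1) i =
      χ x * fderiv ℝ w x (EuclideanSpace.single j 1) i +
        fderiv ℝ χ x (EuclideanSpace.single j 1) * w x i := by
    intro x i j
    rw [fderiv_fun_smul (hχd x) (hwd x)]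
    simp only [add_apply, smul_apply, ContinuousLinearMap.smulRight_apply, PiLp.add_apply,
      PiLp.smul_apply, smul_eq_mul]
  have hsplit : ∀ x : EuclideanSpace ℝ (Fin 3),
      ∑ i, ∑ j, M x i j * fderiv ℝ (fun x => χ x • w x) x (EuclideanSpace.single j 1) i =
      χ x * ∑ i, ∑ j, M x i j * fderiv ℝ w x (EuclideanSpace.single j 1) i +
        ∑ i, ∑ j, M x i j * (fderiv ℝ χ x (EuclideanSpace.single j 1) * w x i) := by
    intro x
    rw [Finset.mul_sum, ← Finset.sum_add_distrib]
    refine Finset.sum_congr rfl fun i _ => ?_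
    rw [Finset.mul_sum, ← Finset.sum_add_distrib]
    refine Finset.sum_congr rfl fun j _ => ?_
    rw [hprod x i j]
    ring
  have key' : ∫ x, (χ x * ∑ i, ∑ j, M x i j * fderiv ℝ w x (EuclideanSpace.single j 1) i +
      ∑ i, ∑ j, M x i j * (fderiv ℝ χ x (EuclideanSpace.single j 1) * w x i)) = 0 :=
    (integral_congr_ae (Eventually.of_forall fun x => (hsplit x).symm)).trans key
  -- both pieces are integrable: continuous on `W`, supported in `tsupport χ ∩ tsupport w ⊆ W`
  have hwi : ∀ i, Continuous (fun y => w y i) := fun i =>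
    (EuclideanSpace.proj i : EuclideanSpace ℝ (Fin 3) →L[ℝ] ℝ).continuous.comp hw.continuous
  have hA : Integrable (fun x =>
      χ x * ∑ i, ∑ j, M x i j * fderiv ℝ w x (EuclideanSpace.single j 1) i) := by
    have h : Integrable (fun x => ∑ i, ∑ j,
        (χ x * fderiv ℝ w x (EuclideanSpace.single j 1) i) * M x i j) := by
      refine integrable_finsetSum _ fun i _ => integrable_finsetSum _ fun j _ => ?_
      have hc : Continuous fun x => χ x * fderiv ℝ w x (EuclideanSpace.single j 1) i :=
        hχ.continuous.mul ((EuclideanSpace.proj i : EuclideanSpace ℝ (Fin 3) →L[ℝ] ℝ).continuous.comp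
          ((hw.continuous_fderiv one_ne_zero).clm_apply continuous_const))
      have hcs : HasCompactSupport fun x => χ x * fderiv ℝ w x (EuclideanSpace.single j 1) i :=
        (((hwc.fderiv_apply (𝕜 := ℝ) (EuclideanSpace.single j 1)).comp_left
          (g := fun v : EuclideanSpace ℝ (Fin 3) => v i) rfl)).mul_left
      have hts : tsupport (fun x => χ x * fderiv ℝ w x (EuclideanSpace.single j 1) i) ⊆ W := by
        refine Subset.trans (subset_inter tsupport_mul_subset_left
          (tsupport_mul_subset_right.trans ?_)) hsub
        exact (tsupport_apply_subset (fun x => fderiv ℝ w x (EuclideanSpace.single j 1)) i).trans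
          (tsupport_fderiv_apply_subset ℝ _)
      exact integrable_mul_of_tsupport_subset hW hc hcs hts (hM i j).continuousOn
    refine h.congr (Eventually.of_forall fun x => ?_)
    simp only [Finset.mul_sum]
    refine Finset.sum_congr rfl fun i _ => Finset.sum_congr rfl fun j _ => ?_
    ring
  have hB : Integrable (fun x =>
      ∑ i, ∑ j, M x i j * (fderiv ℝ χ x (EuclideanSpace.single j 1) * w x i)) := by
    have h : Integrable (fun x => ∑ i, ∑ j,
        (fderiv ℝ χ x (EuclideanSpace.single j 1) * w x i) * M x i j) := by
      refine integrable_finsetSum _ fun i _ => integrable_finsetSum _ fun j _ => ?_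
      have hc : Continuous fun x => fderiv ℝ χ x (EuclideanSpace.single j 1) * w x i :=
        ((hχ.continuous_fderiv one_ne_zero).clm_apply continuous_const).mul (hwi i)
      have hcs : HasCompactSupport fun x => fderiv ℝ χ x (EuclideanSpace.single j 1) * w x i :=
        (hwc.comp_left (g := fun v : EuclideanSpace ℝ (Fin 3) => v i) rfl).mul_left
      have hts : tsupport (fun x => fderiv ℝ χ x (EuclideanSpace.single j 1) * w x i) ⊆ W := by
        refine Subset.trans (subset_inter (tsupport_mul_subset_left.trans
          (tsupport_fderiv_apply_subset ℝ _))
          (tsupport_mul_subset_right.trans (tsupport_apply_subset w i))) hsub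
      exact integrable_mul_of_tsupport_subset hW hc hcs hts (hM i j).continuousOn
    refine h.congr (Eventually.of_forall fun x => ?_)
    exact Finset.sum_congr rfl fun i _ => Finset.sum_congr rfl fun j _ => mul_comm _ _
  rw [integral_add hA hB] at key'
  linarith

/-- **Telescoping across one pure layer.** Let `M`, `M'` be two `C¹` row-divergence-free
stresses on open sets `W`, `W'`, let `χ ∈ C¹` and `w ∈ C¹_c(ℝ³; ℝ³)` with
`tsupport χ ∩ tsupport w` inside both `W` and `W'`, and suppose `M = M'` at every point where
`∇χ ≠ 0`. Then the cut-off pairings agree: `∫ χ Σᵢⱼ Mᵢⱼ (Dw eⱼ)ᵢ = ∫ χ Σᵢⱼ M'ᵢⱼ (Dw eⱼ)ᵢ`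
(both equal `-∫ Σᵢⱼ (·)ᵢⱼ (∂ⱼχ) wᵢ`, `integral_mul_sum_sum_eq_neg`). In the ladder `M` is the
glued stress on `{r₀ < |x|}`, `M'` the `N`-th mollified layer on `{d_N < |x|}`, and `∇χ` lives in
a shell of the pure layer `N` where the two coincide. [folklore] -/
theorem integral_mul_sum_sum_eq_of_fderiv_ne {W W' : Set (EuclideanSpace ℝ (Fin 3))}
    (hW : IsOpen W) (hW' : IsOpen W') {M M' : EuclideanSpace ℝ (Fin 3) → Fin 3 → Fin 3 → ℝ}
    (hM : ∀ i j, ContDiffOn ℝ 1 (fun x => M x i j) W)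
    (hdiv : ∀ x ∈ W, ∀ i, ∑ j, fderiv ℝ (fun y => M y i j) x (EuclideanSpace.single j 1) = 0)
    (hM' : ∀ i j, ContDiffOn ℝ 1 (fun x => M' x i j) W')
    (hdiv' : ∀ x ∈ W', ∀ i, ∑ j, fderiv ℝ (fun y => M' y i j) x (EuclideanSpace.single j 1) = 0)
    {χ : EuclideanSpace ℝ (Fin 3) → ℝ} (hχ : ContDiff ℝ 1 χ)
    {w : EuclideanSpace ℝ (Fin 3) → EuclideanSpace ℝ (Fin 3)} (hw : ContDiff ℝ 1 w)
    (hwc : HasCompactSupport w) (hsub : tsupport χ ∩ tsupport w ⊆ W)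
    (hsub' : tsupport χ ∩ tsupport w ⊆ W')
    (hagree : ∀ x, fderiv ℝ χ x ≠ 0 → M x = M' x) :
    ∫ x, χ x * ∑ i, ∑ j, M x i j * fderiv ℝ w x (EuclideanSpace.single j 1) i =
      ∫ x, χ x * ∑ i, ∑ j, M' x i j * fderiv ℝ w x (EuclideanSpace.single j 1) i := by
  rw [integral_mul_sum_sum_eq_neg hW hM hdiv hχ hw hwc hsub,
    integral_mul_sum_sum_eq_neg hW' hM' hdiv' hχ hw hwc hsub']
  congr 1
  refine integral_congr_ae (Eventually.of_forall fun x => ?_)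
  by_cases hx : fderiv ℝ χ x = 0
  · simp [hx]
  · simp only [hagree x hx]


/-! ### The vector version: divergence-free velocities against scalar tests -/

/-- `⟪u, ∇f⟫ = Df(u)`. [folklore] -/
theorem inner_gradient_eq_fderiv (f : EuclideanSpace ℝ (Fin 3) → ℝ)
    (x v : EuclideanSpace ℝ (Fin 3)) : ⟪v, gradient f x⟫ = fderiv ℝ f x v := by
  rw [real_inner_comm, gradient, InnerProductSpace.toDual_symm_apply]

/-- Expansion of a derivative along a vector in the standard basis:
`Df(x) v = Σᵢ vᵢ Df(x) eᵢ`. [folklore] -/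
theorem fderiv_apply_eq_sum (f : EuclideanSpace ℝ (Fin 3) → ℝ) (x v : EuclideanSpace ℝ (Fin 3)) :
    fderiv ℝ f x v = ∑ i, v i * fderiv ℝ f x (EuclideanSpace.single i 1) := by
  conv_lhs => rw [← (EuclideanSpace.basisFun (Fin 3) ℝ).sum_repr v]
  simp only [map_sum, map_smul, EuclideanSpace.basisFun_repr, EuclideanSpace.basisFun_apply,
    smul_eq_mul]

/-- The coordinate of a derivative of a vector field differentiable at a point:
`(Du(x) e)ᵢ = D(uᵢ)(x) e`. [folklore] -/
theorem fderiv_apply_coord_of_differentiableAt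
    {u : EuclideanSpace ℝ (Fin 3) → EuclideanSpace ℝ (Fin 3)} {x : EuclideanSpace ℝ (Fin 3)}
    (hu : DifferentiableAt ℝ u x) (e : EuclideanSpace ℝ (Fin 3)) (i : Fin 3) :
    fderiv ℝ (fun y => u y i) x e = fderiv ℝ u x e i := by
  have h := ((EuclideanSpace.proj i : EuclideanSpace ℝ (Fin 3) →L[ℝ] ℝ).hasFDerivAt.comp x
    hu.hasFDerivAt).fderiv
  have h' : (fun y => u y i) = (EuclideanSpace.proj i : EuclideanSpace ℝ (Fin 3) →L[ℝ] ℝ) ∘ u :=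
    rfl
  rw [h', h]
  rfl

/-- In coordinates `div u = Σᵢ ∂ᵢuᵢ` at a point of differentiability. [folklore] -/
theorem divergence_eq_sum_fderiv_coord
    {u : EuclideanSpace ℝ (Fin 3) → EuclideanSpace ℝ (Fin 3)} {x : EuclideanSpace ℝ (Fin 3)}
    (hu : DifferentiableAt ℝ u x) :
    VectorCalculus.divergence u x =
      ∑ i, fderiv ℝ (fun y => u y i) x (EuclideanSpace.single i 1) := by
  rw [divergence_eq_sum_inner_fderiv (EuclideanSpace.basisFun (Fin 3) ℝ)]
  refine Finset.sum_congr rfl fun i _ => ?_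
  rw [EuclideanSpace.basisFun_apply, EuclideanSpace.inner_single_left,
    fderiv_apply_coord_of_differentiableAt hu]
  simp

/-- A pairing `f Dg(u) = Σᵢ (f ∂ᵢg) uᵢ` with `f` continuous, `g ∈ C¹`, one of them compactly
supported, `tsupport f ∩ tsupport g ⊆ W`, and `u` continuous on `W`, is integrable. [folklore] -/
theorem integrable_mul_fderiv_apply_of_tsupport_subset {W : Set (EuclideanSpace ℝ (Fin 3))}
    (hW : IsOpen W) {u : EuclideanSpace ℝ (Fin 3) → EuclideanSpace ℝ (Fin 3)}
    (hu : ContinuousOn u W) {f g : EuclideanSpace ℝ (Fin 3) → ℝ} (hf : Continuous f)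
    (hg : ContDiff ℝ 1 g) (hc : HasCompactSupport f ∨ HasCompactSupport g)
    (hfg : tsupport f ∩ tsupport g ⊆ W) :
    Integrable (fun x => f x * fderiv ℝ g x (u x)) := by
  have hexp : ∀ x, f x * fderiv ℝ g x (u x) =
      ∑ i, (f x * fderiv ℝ g x (EuclideanSpace.single i 1)) * u x i := by
    intro x
    rw [fderiv_apply_eq_sum, Finset.mul_sum]
    refine Finset.sum_congr rfl fun i _ => ?_
    ring
  simp_rw [hexp]
  refine integrable_finsetSum _ fun i _ => ?_
  have hci : Continuous fun x => f x * fderiv ℝ g x (EuclideanSpace.single i 1) :=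
    hf.mul ((hg.continuous_fderiv one_ne_zero).clm_apply continuous_const)
  have hcs : HasCompactSupport fun x => f x * fderiv ℝ g x (EuclideanSpace.single i 1) := by
    rcases hc with h | h
    · exact h.mul_right
    · exact (h.fderiv_apply (𝕜 := ℝ) _).mul_left
  have hts : tsupport (fun x => f x * fderiv ℝ g x (EuclideanSpace.single i 1)) ⊆ W :=
    (subset_inter tsupport_mul_subset_left
      (tsupport_mul_subset_right.trans (tsupport_fderiv_apply_subset ℝ _))).trans hfg
  exact integrable_mul_of_tsupport_subset hW hci hcs hts
    ((EuclideanSpace.proj i : EuclideanSpace ℝ (Fin 3) →L[ℝ] ℝ).continuous.comp_continuousOn hu)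

/-- **A `C¹` divergence-free vector field on an open set `W` is orthogonal to gradients of
scalar tests supported in `W`**: `∫ ⟪u, ∇θ⟫ = 0` for `θ ∈ C¹_c`, `tsupport θ ⊆ W`, when
`u ∈ C¹(W; ℝ³)` and `div u = 0` on `W` (values of `u` off `W` irrelevant). [folklore] -/
theorem integral_inner_gradient_eq_zero_of_tsupport_subset {W : Set (EuclideanSpace ℝ (Fin 3))}
    (hW : IsOpen W) {u : EuclideanSpace ℝ (Fin 3) → EuclideanSpace ℝ (Fin 3)}
    (hu : ContDiffOn ℝ 1 u W) (hdiv : ∀ x ∈ W, VectorCalculus.divergence u x = 0)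
    {θ : EuclideanSpace ℝ (Fin 3) → ℝ} (hθ : ContDiff ℝ 1 θ) (hθc : HasCompactSupport θ)
    (hθW : tsupport θ ⊆ W) :
    ∫ x, ⟪u x, gradient θ x⟫ = 0 := by
  have hui : ∀ i, ContDiffOn ℝ 1 (fun y => u y i) W := fun i =>
    (EuclideanSpace.proj i : EuclideanSpace ℝ (Fin 3) →L[ℝ] ℝ).contDiff.comp_contDiffOn hu
  have hexp : ∀ x, ⟪u x, gradient θ x⟫ =
      ∑ i, u x i * fderiv ℝ θ x (EuclideanSpace.single i 1) := by
    intro x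
    rw [inner_gradient_eq_fderiv, fderiv_apply_eq_sum]
  simp_rw [hexp]
  have hint : ∀ i, Integrable (fun x => u x i * fderiv ℝ θ x (EuclideanSpace.single i 1)) := by
    intro i
    have h := integrable_mul_of_tsupport_subset hW
      (f := fun x => fderiv ℝ θ x (EuclideanSpace.single i 1))
      ((hθ.continuous_fderiv one_ne_zero).clm_apply continuous_const)
      (hθc.fderiv_apply (𝕜 := ℝ) (EuclideanSpace.single i 1))
      ((tsupport_fderiv_apply_subset ℝ (EuclideanSpace.single i 1)).trans hθW)
      (hui i).continuousOn
    exact h.congr (Eventually.of_forall fun x => mul_comm _ _)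
  have hint' : ∀ i, Integrable (fun x =>
      θ x * fderiv ℝ (fun y => u y i) x (EuclideanSpace.single i 1)) := fun i =>
    integrable_mul_of_tsupport_subset hW hθ.continuous hθc hθW
      (((hui i).continuousOn_fderiv_of_isOpen hW le_rfl).clm_apply continuousOn_const)
  rw [integral_finsetSum _ fun i _ => hint i]
  have hibp : ∀ i, ∫ x, u x i * fderiv ℝ θ x (EuclideanSpace.single i 1) =
      -∫ x, θ x * fderiv ℝ (fun y => u y i) x (EuclideanSpace.single i 1) := by
    intro i
    have h := integral_mul_fderiv_apply_eq_neg_of_tsupport_subset hW hθ hθc hθW (hui i)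
      (EuclideanSpace.single i 1)
    have hcomm : ∫ x, u x i * fderiv ℝ θ x (EuclideanSpace.single i 1) =
        ∫ x, fderiv ℝ θ x (EuclideanSpace.single i 1) * u x i :=
      integral_congr_ae (Eventually.of_forall fun x => mul_comm _ _)
    linarith
  simp_rw [hibp]
  rw [Finset.sum_neg_distrib, neg_eq_zero, ← integral_finsetSum _ fun i _ => hint' i]
  refine integral_eq_zero_of_ae (Eventually.of_forall fun x => ?_)
  simp only [Pi.zero_apply]
  rw [← Finset.mul_sum]
  by_cases hx : x ∈ W
  · have hud : DifferentiableAt ℝ u x :=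
      (hu.contDiffAt (hW.mem_nhds hx)).differentiableAt one_ne_zero
    rw [← divergence_eq_sum_fderiv_coord hud, hdiv x hx, mul_zero]
  · have h0 : θ x = 0 := image_eq_zero_of_notMem_tsupport fun h => hx (hθW h)
    simp [h0]

/-- **The cut-off commutator for a divergence-free velocity.** With `u` as in
`integral_inner_gradient_eq_zero_of_tsupport_subset`, a `C¹` cut-off `χ` and a `C¹` compactly
supported scalar `θ` with `tsupport χ ∩ tsupport θ ⊆ W`:
`∫ χ ⟪u, ∇θ⟫ = -∫ θ ⟪u, ∇χ⟫` (test against `χ θ`). [folklore] -/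
theorem integral_mul_inner_gradient_eq_neg {W : Set (EuclideanSpace ℝ (Fin 3))}
    (hW : IsOpen W) {u : EuclideanSpace ℝ (Fin 3) → EuclideanSpace ℝ (Fin 3)}
    (hu : ContDiffOn ℝ 1 u W) (hdiv : ∀ x ∈ W, VectorCalculus.divergence u x = 0)
    {χ : EuclideanSpace ℝ (Fin 3) → ℝ} (hχ : ContDiff ℝ 1 χ)
    {θ : EuclideanSpace ℝ (Fin 3) → ℝ} (hθ : ContDiff ℝ 1 θ) (hθc : HasCompactSupport θ)
    (hsub : tsupport χ ∩ tsupport θ ⊆ W) :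
    ∫ x, χ x * ⟪u x, gradient θ x⟫ = -∫ x, θ x * ⟪u x, gradient χ x⟫ := by
  have hφ : ContDiff ℝ 1 (fun x => χ x * θ x) := hχ.mul hθ
  have hφc : HasCompactSupport (fun x => χ x * θ x) := hθc.mul_left (f := χ)
  have hφW : tsupport (fun x => χ x * θ x) ⊆ W :=
    (subset_inter tsupport_mul_subset_left tsupport_mul_subset_right).trans hsub
  have key := integral_inner_gradient_eq_zero_of_tsupport_subset hW hu hdiv hφ hφc hφW
  simp_rw [inner_gradient_eq_fderiv] at key ⊢
  have hprod : ∀ x, fderiv ℝ (fun x => χ x * θ x) x (u x) =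
      χ x * fderiv ℝ θ x (u x) + θ x * fderiv ℝ χ x (u x) := by
    intro x
    rw [fderiv_fun_mul (hχ.differentiable one_ne_zero x) (hθ.differentiable one_ne_zero x)]
    simp only [add_apply, smul_apply, smul_eq_mul]
  have key' : ∫ x, (χ x * fderiv ℝ θ x (u x) + θ x * fderiv ℝ χ x (u x)) = 0 :=
    (integral_congr_ae (Eventually.of_forall fun x => (hprod x).symm)).trans key
  have hA : Integrable (fun x => χ x * fderiv ℝ θ x (u x)) :=
    integrable_mul_fderiv_apply_of_tsupport_subset hW hu.continuousOn hχ.continuous hθ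
      (Or.inr hθc) hsub
  have hB : Integrable (fun x => θ x * fderiv ℝ χ x (u x)) :=
    integrable_mul_fderiv_apply_of_tsupport_subset hW hu.continuousOn hθ.continuous hχ
      (Or.inl hθc) (by rwa [inter_comm])
  rw [integral_add hA hB] at key'
  linarith

/-! ### Radial cut-offs across a shell -/

/-- **Radial cut-off across the shell `s < |x| < s'`.** For `0 < s < s'` there are smooth
`χ, ψ : ℝ³ → ℝ` with `χ + ψ = 1`, `0 ≤ ψ ≤ 1`, `ψ` compactly supported with `ψ ≠ 0 ⟹ |x| < s'`
and `ψ = 1` on `|x| ≤ s`, while `tsupport χ ⊆ {s < |x|}` and `∇χ(x) ≠ 0 ⟹ s < |x| < s'`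
(`ψ` = Mathlib's bump at the origin with radii `(2s + s')/3 < (s + 2s')/3`). In the ladder the
transition shell is placed inside a pure layer. [folklore] -/
theorem exists_radial_cutoff {s s' : ℝ} (hs : 0 < s) (hss' : s < s') :
    ∃ χ ψ : EuclideanSpace ℝ (Fin 3) → ℝ, ContDiff ℝ ∞ χ ∧ ContDiff ℝ ∞ ψ ∧
      (∀ x, χ x + ψ x = 1) ∧ (∀ x, 0 ≤ ψ x ∧ ψ x ≤ 1) ∧ HasCompactSupport ψ ∧
      (∀ x, ψ x ≠ 0 → ‖x‖ < s') ∧ (∀ x, ‖x‖ ≤ s → ψ x = 1) ∧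
      tsupport χ ⊆ {x | s < ‖x‖} ∧
      (∀ x, fderiv ℝ χ x ≠ 0 → s < ‖x‖ ∧ ‖x‖ < s') := by
  let b : ContDiffBump (0 : EuclideanSpace ℝ (Fin 3)) :=
    ⟨(2 * s + s') / 3, (s + 2 * s') / 3, by linarith, by linarith⟩
  have hIn : b.rIn = (2 * s + s') / 3 := rfl
  have hOut : b.rOut = (s + 2 * s') / 3 := rfl
  set ψ : EuclideanSpace ℝ (Fin 3) → ℝ := fun x => b x with hψ
  set χ : EuclideanSpace ℝ (Fin 3) → ℝ := fun x => 1 - ψ x with hχ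
  -- `ψ = 1` on `|x| ≤ rIn`, `ψ = 0` on `rOut ≤ |x|`
  have hψ1 : ∀ x : EuclideanSpace ℝ (Fin 3), ‖x‖ ≤ (2 * s + s') / 3 → ψ x = 1 := fun x hx =>
    b.one_of_mem_closedBall (by rwa [mem_closedBall, dist_zero_right, hIn])
  have hψ0 : ∀ x : EuclideanSpace ℝ (Fin 3), (s + 2 * s') / 3 ≤ ‖x‖ → ψ x = 0 := fun x hx =>
    b.zero_of_le_dist (by rwa [dist_zero_right, hOut])
  refine ⟨χ, ψ, contDiff_const.sub b.contDiff, b.contDiff, fun x => by simp [hχ], fun x =>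
    ⟨b.nonneg, b.le_one⟩, b.hasCompactSupport, fun x hx => ?_, fun x hx => hψ1 x (by linarith),
    ?_, fun x hx => ?_⟩
  · by_contra h
    exact hx (hψ0 x (by linarith [not_lt.1 h]))
  · -- `support χ ⊆ {rIn < |x|}`, a subset of the closed set `{rIn ≤ |x|} ⊆ {s < |x|}`
    have hsupp : support χ ⊆ {x : EuclideanSpace ℝ (Fin 3) | (2 * s + s') / 3 ≤ ‖x‖} := by
      intro x hx
      by_contra h
      exact hx (by simp [hχ, hψ1 x (le_of_lt (not_le.1 h))])
    refine (closure_minimal hsupp (isClosed_le continuous_const continuous_norm)).trans ?_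
    intro x hx
    simp only [mem_setOf_eq] at hx ⊢
    linarith
  · -- `∇χ` vanishes where `χ` is locally constant: off the closed shell `rIn ≤ |x| ≤ rOut`
    constructor
    · by_contra h
      have hlt : ‖x‖ < (2 * s + s') / 3 := by linarith [not_lt.1 h]
      refine hx ?_
      have hloc : χ =ᶠ[𝓝 x] fun _ => 0 := by
        filter_upwards [(isOpen_lt continuous_norm continuous_const).mem_nhds hlt] with y hy
        simp [hχ, hψ1 y (le_of_lt hy)]
      rw [hloc.fderiv_eq]
      simp
    · by_contra h
      have hlt : (s + 2 * s') / 3 < ‖x‖ := by linarith [not_lt.1 h]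
      refine hx ?_
      have hloc : χ =ᶠ[𝓝 x] fun _ => 1 := by
        filter_upwards [(isOpen_lt continuous_const continuous_norm).mem_nhds hlt] with y hy
        simp [hχ, hψ0 y (le_of_lt hy)]
      rw [hloc.fderiv_eq]
      simp

end EulerReynoldsLadder

end Literature.Analysis.FluidPDE

end
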